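import Summits.CriticalPhenomena.SAWScalingLimit.Theses.SAWSteinDefect
import Summits.CriticalPhenomena.SAWScalingLimit.Theorems.SAWSteinDefectAvoidanceLimitTransfer
import Summits.CriticalPhenomena.SAWScalingLimit.Theorems.SAWChargeContinuationSAWAvoidanceLawOfScalingLimit

/-!
# Strategist r1 evidence for crux `BalanceChannel` (stmt-CriticalPhenomena-7509): the crux is
`AvoidanceLimit` (stmt-CriticalPhenomena-4981 ≡ stmt-CriticalPhenomena-10649) in q-coordinates

Route `SAWSteinDefect` of `CriticalPhenomena/SAWScalingLimit`.  Kernel-checked, sorry-free: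

* `balanceChannel_iff_avoidanceLimit :
    DefectIdentity → ExcursionInitialValue → CubicRemainder → (BalanceChannel ↔ AvoidanceLimit)` —
  modulo the route's own bookkeeping items (the exact Stein/Dynkin identity `DefectIdentity`,
  support, "provable-now"; the initial value `ExcursionInitialValue`, crux r4, discrete potential
  theory; the Taylor remainder `CubicRemainder`, crux r3) the deciding crux `BalanceChannel` (r2) IS
  the 5/8 avoidance law `AvoidanceLimit`, the deciding crux of the sibling route `SAWLoopFugacityFlow`
  (stmt-10649, `Theorems/SAWSteinDefectAvoidanceLimitTransfer`: 4981 ↔ 10649 by `rfl`).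
  The `←` direction is new here; the `→` direction is the text of the open support item
  `DefectToAvoidance` (stmt-CriticalPhenomena-7521), proved below as `defectToAvoidance`.
* `balanceChannel_of_sawScalingLimit :
    SAWScalingLimit → DefectIdentity → ExcursionInitialValue → CubicRemainder → BalanceChannel` —
  through the LANDED `avoidanceLimit_of_sawScalingLimit` (Theorems/SAWChargeContinuationSAWAvoidance…):
  the crux is a CONSEQUENCE of the sub-problem modulo the same bookkeeping (the `S → C` probe closes
  modulo DI ∧ V ∧ R; the `C → S` probe does not: B ⇏ S without `EventualTight ∧ SimpleSubseqLimits`).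

Mathematics: finite telescoping on a finite probability space.  With `f(q) = q^{5/8}` and the Lean
conventions `0 ^ (-3/8) = 0`, `x / 0 = 0`, the one-step identity
`balance(q, q') + cubic(q, q') = f(q') − f(q)` holds for ALL real `q, q'` (`Real.rpow_sub_one` for
`q ≠ 0`, `Real.zero_rpow` at `q = 0`), so `Σ_{n<N} balance_n = f(Q_N) − f(Q_0) − Σ_{n<N} cubic_n`
pointwise; `Q_0 = H'([a_δ]; a_δ)/H([a_δ]; a_δ)` is deterministic once `δ a_δ ∈ cl D'` (eventually, by
reachability, `a ≠ b` and ball agreement near `a`); integrate against the (eventually probability,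
finitely supported) SAW law and pass to the limit with `DefectIdentity` (`P_δ(avoid) = E f(Q_N)`),
`ExcursionInitialValue` (`Q_0 → d`), `CubicRemainder` (`E Σ cubic → 0`) and continuity of
`x ↦ x^{5/8}`, `ENNReal.ofReal`, `ENNReal.toReal`.
-/

noncomputable section

open scoped BigOperators Topology Manifold Classical MeasureTheory ProbabilityTheory Matrix InnerProductSpace ComplexConjugate ContinuousMap ENNReal NNReal
open Filter Set Function TopologicalSpace MeasureTheory
open Literature.Probability.RandomPlanarGeometry Literature.Probability.LatticeModels
open Summit.CriticalPhenomena.SAWScalingLimit.Theses.SAWSteinDefect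
open Summit.CriticalPhenomena.SAWScalingLimit.Theorems.SAWLoopFugacityFlowAssembly
  (finite_domainSAW eventually_isProbabilityMeasure_law exists_restrictionData)

namespace Summit.CriticalPhenomena.SAWScalingLimit.Cruxes.BalanceChannel.Strategist

/-! ### 1. Vocabulary (verbatim from the crux, as in `Lines/birth.lean`) -/

/-- The lattice excursion mass `H_δ(S; w)` — VERBATIM the crux's `let H`. -/
def excMass (D : DobrushinDomain) (b : ℝ → Site 2) (δ : ℝ) (S : List (Site 2)) (w : Site 2) : ℝ :=
  ∑' ω : (discreteDomainGraph D.carrier δ).Walk w (b δ),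
    if (∀ v ∈ ω.support.tail, v ∉ S) ∧ b δ ∉ ω.support.dropLast then (1 / 4 : ℝ) ^ ω.length else 0

/-- The restricted excursion mass `H'_δ(S; w)` — VERBATIM the crux's `let H'`. -/
def excMass' (D D' : DobrushinDomain) (b : ℝ → Site 2) (δ : ℝ) (S : List (Site 2)) (w : Site 2) : ℝ :=
  ∑' ω : (discreteDomainGraph D.carrier δ).Walk w (b δ),
    if (∀ v ∈ ω.support.tail, v ∉ S) ∧ b δ ∉ ω.support.dropLast ∧
        Set.range (ω.toCurve (meshPoint δ)) ⊆ closure D'.carrier then (1 / 4 : ℝ) ^ ω.length else 0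

/-- The lattice excursion-avoidance ratio `Q_n` of the past — VERBATIM the crux's `let Q`. -/
def ratio (D D' : DobrushinDomain) (a b : ℝ → Site 2) (δ : ℝ)
    (γ : SAW.DomainSAW D.carrier δ (a δ) (b δ)) (n : ℕ) : ℝ :=
  if Set.range ((γ.walk.take n).toCurve (meshPoint δ)) ⊆ closure D'.carrier then
    excMass' D D' b δ (γ.walk.take n).support (γ.walk.getVert n) /
      excMass D b δ (γ.walk.take n).support (γ.walk.getVert n)
  else 0

/-- The initial ratio `Q_0 = H'([a_δ]; a_δ) / H([a_δ]; a_δ)` (the quantity of `ExcursionInitialValue`). -/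
def initialRatio (D D' : DobrushinDomain) (a b : ℝ → Site 2) (δ : ℝ) : ℝ :=
  excMass' D D' b δ [a δ] (a δ) / excMass D b δ [a δ] (a δ)

/-- One-step balance defect `f'(q)[(q' − q) − (3/16)(q' − q)²/q]` — VERBATIM the crux's summand. -/
def balanceTerm (q q' : ℝ) : ℝ :=
  (5 / 8 : ℝ) * q ^ (-(3 : ℝ) / 8) * ((q' - q) - (3 / 16 : ℝ) * (q' - q) ^ 2 / q)

/-- One-step cubic Taylor remainder — VERBATIM the summand of `CubicRemainder`. -/
def cubicTerm (q q' : ℝ) : ℝ :=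
  q' ^ ((5 : ℝ) / 8) - q ^ ((5 : ℝ) / 8) - (5 / 8 : ℝ) * q ^ (-(3 : ℝ) / 8) * (q' - q) +
    (15 / 128 : ℝ) * q ^ (-(11 : ℝ) / 8) * (q' - q) ^ 2

/-- The balance sum `B` along a SAW (integrand of `BalanceChannel`). -/
def balanceSum (D D' : DobrushinDomain) (a b : ℝ → Site 2) (δ : ℝ)
    (γ : SAW.DomainSAW D.carrier δ (a δ) (b δ)) : ℝ :=
  ∑ n ∈ Finset.range γ.length, balanceTerm (ratio D D' a b δ γ n) (ratio D D' a b δ γ (n + 1))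

/-- The remainder sum along a SAW (integrand of `CubicRemainder`). -/
def remainderSum (D D' : DobrushinDomain) (a b : ℝ → Site 2) (δ : ℝ)
    (γ : SAW.DomainSAW D.carrier δ (a δ) (b δ)) : ℝ :=
  ∑ n ∈ Finset.range γ.length, cubicTerm (ratio D D' a b δ γ n) (ratio D D' a b δ γ (n + 1))

/-! ### 2. The four items, zeta-reduced (each definitionally the route decl) -/

/-- `BalanceChannel` with its `let`s zeta-reduced. -/
def BalanceChannel' : Prop :=
  ∀ (D D' : DobrushinDomain) (a b : ℝ → Site 2), SAW.IsEndpointApprox D a b → D'.carrier ⊆ D.carrier →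
    D'.pt 0 = D.pt 0 → D'.pt 1 = D.pt 1 →
    (∃ ε : ℝ, 0 < ε ∧ D'.carrier ∩ Metric.ball (D.pt 0) ε = D.carrier ∩ Metric.ball (D.pt 0) ε ∧
      D'.carrier ∩ Metric.ball (D.pt 1) ε = D.carrier ∩ Metric.ball (D.pt 1) ε) →
    Tendsto (fun δ => ∫ γ, balanceSum D D' a b δ γ ∂(SAW.law D.carrier δ (a δ) (b δ)))
      (𝓝[>] 0) (𝓝 0)

theorem balanceChannel_iff : BalanceChannel' ↔ BalanceChannel := Iff.rfl

/-- `CubicRemainder` with its `let`s zeta-reduced. -/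
def CubicRemainder' : Prop :=
  ∀ (D D' : DobrushinDomain) (a b : ℝ → Site 2), SAW.IsEndpointApprox D a b → D'.carrier ⊆ D.carrier →
    D'.pt 0 = D.pt 0 → D'.pt 1 = D.pt 1 →
    (∃ ε : ℝ, 0 < ε ∧ D'.carrier ∩ Metric.ball (D.pt 0) ε = D.carrier ∩ Metric.ball (D.pt 0) ε ∧
      D'.carrier ∩ Metric.ball (D.pt 1) ε = D.carrier ∩ Metric.ball (D.pt 1) ε) →
    Tendsto (fun δ => ∫ γ, remainderSum D D' a b δ γ ∂(SAW.law D.carrier δ (a δ) (b δ)))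
      (𝓝[>] 0) (𝓝 0)

theorem cubicRemainder_iff : CubicRemainder' ↔ CubicRemainder := Iff.rfl

/-- `ExcursionInitialValue` with its `let`s zeta-reduced. -/
def ExcursionInitialValue' : Prop :=
  ∀ (D D' : DobrushinDomain) (a b : ℝ → Site 2), SAW.IsEndpointApprox D a b → D'.carrier ⊆ D.carrier →
    D'.pt 0 = D.pt 0 → D'.pt 1 = D.pt 1 →
    (∃ ε : ℝ, 0 < ε ∧ D'.carrier ∩ Metric.ball (D.pt 0) ε = D.carrier ∩ Metric.ball (D.pt 0) ε ∧
      D'.carrier ∩ Metric.ball (D.pt 1) ε = D.carrier ∩ Metric.ball (D.pt 1) ε) →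
    ∀ (φ : ConformalEquiv UpperHalfPlane.upperHalfPlaneSet D.carrier), D.IsChordalUniformizing φ →
    ∀ (Φ : ConformalEquiv (UpperHalfPlane.upperHalfPlaneSet \ φ.pullbackHull D')
        UpperHalfPlane.upperHalfPlaneSet) (d : ℝ),
      IsRestrictionMap (φ.pullbackHull D') Φ → HasRestrictionDeriv (φ.pullbackHull D') Φ d →
      Tendsto (fun δ => excMass' D D' b δ [a δ] (a δ) / excMass D b δ [a δ] (a δ)) (𝓝[>] 0) (𝓝 d)

theorem excursionInitialValue_iff : ExcursionInitialValue' ↔ ExcursionInitialValue := Iff.rfl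

/-- `DefectIdentity` with its `let`s zeta-reduced. -/
def DefectIdentity' : Prop :=
  ∀ (D D' : DobrushinDomain) (a b : ℝ → Site 2), SAW.IsEndpointApprox D a b → D'.carrier ⊆ D.carrier →
    D'.pt 0 = D.pt 0 → D'.pt 1 = D.pt 1 →
    (∃ ε : ℝ, 0 < ε ∧ D'.carrier ∩ Metric.ball (D.pt 0) ε = D.carrier ∩ Metric.ball (D.pt 0) ε ∧
      D'.carrier ∩ Metric.ball (D.pt 1) ε = D.carrier ∩ Metric.ball (D.pt 1) ε) →
    ∀ᶠ δ in 𝓝[>] 0,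
      ((SAW.law D.carrier δ (a δ) (b δ)).map (fun γ => γ.curve))
          (CurveClass.rangeSubset (closure D'.carrier)) =
        ENNReal.ofReal (∫ γ, ratio D D' a b δ γ γ.length ^ ((5 : ℝ) / 8)
          ∂(SAW.law D.carrier δ (a δ) (b δ)))

theorem defectIdentity_iff : DefectIdentity' ↔ DefectIdentity := Iff.rfl

/-! ### 3. Algebra: the one-step identity and finite telescoping (all real `q`, no sign condition) -/

/-- `balance + cubic = f(q') − f(q)` for ALL real `q, q'` under Lean's conventions
(`0 ^ (-3/8) = 0 ^ (-11/8) = 0`, `x / 0 = 0`; `q ^ (-11/8) = q ^ (-3/8) / q` for `q ≠ 0`). -/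
theorem balanceTerm_add_cubicTerm (q q' : ℝ) :
    balanceTerm q q' + cubicTerm q q' = q' ^ ((5 : ℝ) / 8) - q ^ ((5 : ℝ) / 8) := by
  unfold balanceTerm cubicTerm
  rcases eq_or_ne q 0 with rfl | hq
  · rw [Real.zero_rpow (by norm_num : (-(3 : ℝ) / 8) ≠ 0),
      Real.zero_rpow (by norm_num : (-(11 : ℝ) / 8) ≠ 0)]
    ring
  · rw [show (-(11 : ℝ) / 8) = (-(3 : ℝ) / 8) - 1 by norm_num, Real.rpow_sub_one hq]
    ring

theorem balanceTerm_eq (q q' : ℝ) :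
    balanceTerm q q' = q' ^ ((5 : ℝ) / 8) - q ^ ((5 : ℝ) / 8) - cubicTerm q q' := by
  rw [← balanceTerm_add_cubicTerm]; ring

/-- Pointwise telescoping: `B(γ) = f(Q_N) − f(Q_0) − Rem(γ)`, `N = |γ|`. -/
theorem balanceSum_eq {D D' : DobrushinDomain} {a b : ℝ → Site 2} {δ : ℝ}
    (γ : SAW.DomainSAW D.carrier δ (a δ) (b δ)) :
    balanceSum D D' a b δ γ = ratio D D' a b δ γ γ.length ^ ((5 : ℝ) / 8) -
      ratio D D' a b δ γ 0 ^ ((5 : ℝ) / 8) - remainderSum D D' a b δ γ := by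
  unfold balanceSum remainderSum
  have key : ∀ N : ℕ,
      ∑ n ∈ Finset.range N, balanceTerm (ratio D D' a b δ γ n) (ratio D D' a b δ γ (n + 1)) =
        ratio D D' a b δ γ N ^ ((5 : ℝ) / 8) - ratio D D' a b δ γ 0 ^ ((5 : ℝ) / 8) -
          ∑ n ∈ Finset.range N, cubicTerm (ratio D D' a b δ γ n) (ratio D D' a b δ γ (n + 1)) := by
    intro N
    induction N with
    | zero => simp
    | succ N ih => rw [Finset.sum_range_succ, Finset.sum_range_succ, ih, balanceTerm_eq]; ring
  exact key γ.length

/-! ### 4. Signs and the initial value -/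

theorem excMass_nonneg (D : DobrushinDomain) (b : ℝ → Site 2) (δ : ℝ) (S : List (Site 2))
    (w : Site 2) : 0 ≤ excMass D b δ S w :=
  tsum_nonneg fun ω => by
    split_ifs
    · positivity
    · exact le_rfl

theorem excMass'_nonneg (D D' : DobrushinDomain) (b : ℝ → Site 2) (δ : ℝ) (S : List (Site 2))
    (w : Site 2) : 0 ≤ excMass' D D' b δ S w :=
  tsum_nonneg fun ω => by
    split_ifs
    · positivity
    · exact le_rfl

theorem ratio_nonneg {D D' : DobrushinDomain} {a b : ℝ → Site 2} {δ : ℝ}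
    (γ : SAW.DomainSAW D.carrier δ (a δ) (b δ)) (n : ℕ) : 0 ≤ ratio D D' a b δ γ n := by
  unfold ratio
  split_ifs
  · exact div_nonneg (excMass'_nonneg _ _ _ _ _ _) (excMass_nonneg _ _ _ _ _)
  · exact le_rfl

theorem initialRatio_nonneg (D D' : DobrushinDomain) (a b : ℝ → Site 2) (δ : ℝ) :
    0 ≤ initialRatio D D' a b δ :=
  div_nonneg (excMass'_nonneg _ _ _ _ _ _) (excMass_nonneg _ _ _ _ _)

/-- The support of the length-`0` prefix of a walk is its base vertex. -/
theorem support_take_zero {V : Type*} {G : SimpleGraph V} {u v : V} (p : G.Walk u v) :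
    (p.take 0).support = [u] := by
  rw [SimpleGraph.Walk.support_take, ← SimpleGraph.Walk.cons_tail_support p]
  rfl

/-- The polyline of the length-`0` prefix of a walk is the (embedded) base vertex. -/
theorem range_toCurve_take_zero {V : Type*} {G : SimpleGraph V} {u v : V} (emb : V → ℂ)
    (p : G.Walk u v) : Set.range ((p.take 0).toCurve emb) = {emb u} := by
  simp [SimpleGraph.Walk.toCurve, Literature.Probability.LatticeModels.polyline]

/-- `Q_0 = H'([a_δ]; a_δ)/H([a_δ]; a_δ)` once the start point lies in `cl D'`. -/
theorem ratio_zero {D D' : DobrushinDomain} {a b : ℝ → Site 2} {δ : ℝ}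
    (γ : SAW.DomainSAW D.carrier δ (a δ) (b δ)) (ha : meshPoint δ (a δ) ∈ closure D'.carrier) :
    ratio D D' a b δ γ 0 = initialRatio D D' a b δ := by
  unfold ratio initialRatio
  rw [if_pos (by rw [range_toCurve_take_zero]; exact Set.singleton_subset_iff.2 ha),
    support_take_zero, SimpleGraph.Walk.getVert_zero]

/-! ### 5. Eventual lattice bookkeeping along an endpoint approximation -/

variable {D D' : DobrushinDomain} {a b : ℝ → Site 2}

/-- Eventually `a_δ ≠ b_δ` (the mesh points tend to the distinct marked points). -/
theorem eventually_ne (hab : SAW.IsEndpointApprox D a b) : ∀ᶠ δ in 𝓝[>] (0 : ℝ), a δ ≠ b δ := by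
  have hpq : D.pt 0 ≠ D.pt 1 := fun h => absurd (D.pt_injective h) (by decide)
  have hr : 0 < dist (D.pt 0) (D.pt 1) / 2 := by
    have := dist_pos.2 hpq
    positivity
  have ha := (Metric.tendsto_nhds.1 hab.tendsto_fst) _ hr
  have hb := (Metric.tendsto_nhds.1 hab.tendsto_snd) _ hr
  filter_upwards [ha, hb] with δ hδa hδb heq
  rw [heq] at hδa
  have h3 := dist_triangle (D.pt 0) (meshPoint δ (b δ)) (D.pt 1)
  rw [dist_comm] at hδa
  linarith

/-- Eventually the start point `δ a_δ` lies in `cl D'` (reachability puts `a_δ` in `Ω_δ`, hence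
`δ a_δ ∈ D`, and `D'` agrees with `D` in a ball around `a = lim δ a_δ`). -/
theorem eventually_start_mem_closure (hab : SAW.IsEndpointApprox D a b)
    (hball : ∃ ε : ℝ, 0 < ε ∧ D'.carrier ∩ Metric.ball (D.pt 0) ε = D.carrier ∩ Metric.ball (D.pt 0) ε ∧
      D'.carrier ∩ Metric.ball (D.pt 1) ε = D.carrier ∩ Metric.ball (D.pt 1) ε) :
    ∀ᶠ δ in 𝓝[>] (0 : ℝ), meshPoint δ (a δ) ∈ closure D'.carrier := by
  obtain ⟨ε, hε, h0, -⟩ := hball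
  have hA : ∀ᶠ δ in 𝓝[>] (0 : ℝ), meshPoint δ (a δ) ∈ Metric.ball (D.pt 0) ε :=
    hab.tendsto_fst (Metric.ball_mem_nhds _ hε)
  filter_upwards [hab.reachable, eventually_ne hab, hA] with δ hr hne ha
  obtain ⟨p⟩ := hr
  obtain ⟨w, hadj, -, -⟩ := p.exists_eq_cons_of_ne hne
  have haD : a δ ∈ meshDomain D.carrier δ := (discreteDomainGraph_adj_iff.1 hadj).2.1
  have haΩ : meshPoint δ (a δ) ∈ D.carrier :=
    mem_meshVertices_iff.1 (meshDomain_subset_meshVertices _ _ haD)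
  have hmem : meshPoint δ (a δ) ∈ D'.carrier ∩ Metric.ball (D.pt 0) ε := by
    rw [h0]
    exact ⟨haΩ, ha⟩
  exact subset_closure hmem.1

/-- Discrete σ-algebra: singletons are measurable. -/
instance strategistMeasurableSingletonClass {Ω : Set ℂ} {δ : ℝ} {u v : Site 2} :
    MeasurableSingletonClass (SAW.DomainSAW Ω δ u v) :=
  ⟨fun _ => MeasurableSpace.measurableSet_top⟩

/-- **The integrated telescoping identity**, eventually in `δ`:
`E_δ B = E_δ f(Q_N) − f(Q_0(δ)) − E_δ Rem` (finite probability space, `Q_0` deterministic). -/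
theorem eventually_integral_balanceSum (hab : SAW.IsEndpointApprox D a b)
    (hball : ∃ ε : ℝ, 0 < ε ∧ D'.carrier ∩ Metric.ball (D.pt 0) ε = D.carrier ∩ Metric.ball (D.pt 0) ε ∧
      D'.carrier ∩ Metric.ball (D.pt 1) ε = D.carrier ∩ Metric.ball (D.pt 1) ε) :
    ∀ᶠ δ in 𝓝[>] (0 : ℝ),
      ∫ γ, balanceSum D D' a b δ γ ∂(SAW.law D.carrier δ (a δ) (b δ)) =
        (∫ γ, ratio D D' a b δ γ γ.length ^ ((5 : ℝ) / 8) ∂(SAW.law D.carrier δ (a δ) (b δ))) -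
          initialRatio D D' a b δ ^ ((5 : ℝ) / 8) -
          ∫ γ, remainderSum D D' a b δ γ ∂(SAW.law D.carrier δ (a δ) (b δ)) := by
  filter_upwards [eventually_isProbabilityMeasure_law hab, eventually_start_mem_closure hab hball,
    self_mem_nhdsWithin] with δ hP hst hδ
  haveI := hP
  haveI : Finite (SAW.DomainSAW D.carrier δ (a δ) (b δ)) :=
    finite_domainSAW D.isBounded (Set.mem_Ioi.1 hδ) _ _
  have hint : ∀ f : SAW.DomainSAW D.carrier δ (a δ) (b δ) → ℝ,
      Integrable f (SAW.law D.carrier δ (a δ) (b δ)) := fun f => Integrable.of_finite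
  have hpt : ∀ γ : SAW.DomainSAW D.carrier δ (a δ) (b δ), balanceSum D D' a b δ γ =
      ratio D D' a b δ γ γ.length ^ ((5 : ℝ) / 8) - initialRatio D D' a b δ ^ ((5 : ℝ) / 8) -
        remainderSum D D' a b δ γ := fun γ => by
    rw [balanceSum_eq, ratio_zero γ hst]
  simp_rw [hpt]
  rw [integral_sub (hint _) (hint _), integral_sub (hint _) (hint _), integral_const, smul_eq_mul,
    probReal_univ, one_mul]

/-! ### 6. The equivalence -/

/-- **`AvoidanceLimit → BalanceChannel`** modulo `DefectIdentity`, `ExcursionInitialValue`,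
`CubicRemainder` (zeta-reduced forms). -/
theorem balanceChannel'_of (hAL : AvoidanceLimit) (hDI : DefectIdentity') (hV : ExcursionInitialValue')
    (hR : CubicRemainder') : BalanceChannel' := by
  intro D D' a b hab hsub h0 h1 hball
  obtain ⟨φ, hφ, Φ, d, hΦ, hd⟩ := exists_restrictionData D D' hsub h0 h1 hball
  have hA := hAL D D' a b hab hsub h0 h1 hball φ hφ Φ d hΦ hd
  have hVt := hV D D' a b hab hsub h0 h1 hball φ hφ Φ d hΦ hd
  change Tendsto (fun δ => initialRatio D D' a b δ) (𝓝[>] 0) (𝓝 d) at hVt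
  have hRt := hR D D' a b hab hsub h0 h1 hball
  have hd0 : 0 ≤ d := ge_of_tendsto' hVt fun δ => initialRatio_nonneg D D' a b δ
  have hL1 : Tendsto (fun δ => (((SAW.law D.carrier δ (a δ) (b δ)).map (fun γ => γ.curve))
      (CurveClass.rangeSubset (closure D'.carrier))).toReal) (𝓝[>] 0) (𝓝 (d ^ ((5 : ℝ) / 8))) := by
    have := (ENNReal.tendsto_toReal (ENNReal.ofReal_ne_top (r := d ^ ((5 : ℝ) / 8)))).comp hA
    rwa [ENNReal.toReal_ofReal (Real.rpow_nonneg hd0 _)] at this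
  have hlim := (hL1.sub (hVt.rpow_const (p := (5 : ℝ) / 8) (Or.inr (by norm_num)))).sub hRt
  simp only [sub_self] at hlim
  refine hlim.congr' ?_
  filter_upwards [hDI D D' a b hab hsub h0 h1 hball, eventually_integral_balanceSum hab hball]
    with δ hDIδ hId
  rw [hId, hDIδ, ENNReal.toReal_ofReal (integral_nonneg fun γ => Real.rpow_nonneg (ratio_nonneg γ _) _)]

/-- **`BalanceChannel → AvoidanceLimit`** modulo the same three items (zeta-reduced forms): the text
of the open support item `DefectToAvoidance` (stmt-CriticalPhenomena-7521). -/
theorem avoidanceLimit_of (hDI : DefectIdentity') (hV : ExcursionInitialValue') (hB : BalanceChannel')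
    (hR : CubicRemainder') : AvoidanceLimit := by
  intro D D' a b hab hsub h0 h1 hball φ hφ Φ d hΦ hd
  have hVt := hV D D' a b hab hsub h0 h1 hball φ hφ Φ d hΦ hd
  change Tendsto (fun δ => initialRatio D D' a b δ) (𝓝[>] 0) (𝓝 d) at hVt
  have hBt := hB D D' a b hab hsub h0 h1 hball
  have hRt := hR D D' a b hab hsub h0 h1 hball
  have hlim : Tendsto (fun δ => (∫ γ, balanceSum D D' a b δ γ ∂(SAW.law D.carrier δ (a δ) (b δ))) +
      initialRatio D D' a b δ ^ ((5 : ℝ) / 8) +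
        ∫ γ, remainderSum D D' a b δ γ ∂(SAW.law D.carrier δ (a δ) (b δ)))
      (𝓝[>] 0) (𝓝 (d ^ ((5 : ℝ) / 8))) := by
    have := (hBt.add (hVt.rpow_const (p := (5 : ℝ) / 8) (Or.inr (by norm_num)))).add hRt
    rwa [zero_add, add_zero] at this
  refine (ENNReal.tendsto_ofReal hlim).congr' ?_
  filter_upwards [hDI D D' a b hab hsub h0 h1 hball, eventually_integral_balanceSum hab hball]
    with δ hDIδ hId
  rw [hDIδ, hId]
  congr 1
  ring

/-- **The crux decided modulo bookkeeping: `BalanceChannel ↔ AvoidanceLimit`** under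
`DefectIdentity`, `ExcursionInitialValue`, `CubicRemainder` (the route's own items 7520, 7519, 7518). -/
theorem balanceChannel_iff_avoidanceLimit (hDI : DefectIdentity) (hV : ExcursionInitialValue)
    (hR : CubicRemainder) : BalanceChannel ↔ AvoidanceLimit :=
  ⟨fun hB => avoidanceLimit_of (defectIdentity_iff.2 hDI) (excursionInitialValue_iff.2 hV)
      (balanceChannel_iff.2 hB) (cubicRemainder_iff.2 hR),
    fun hAL => balanceChannel_iff.1 (balanceChannel'_of hAL (defectIdentity_iff.2 hDI)
      (excursionInitialValue_iff.2 hV) (cubicRemainder_iff.2 hR))⟩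

/-- `AvoidanceLimit → (DI → V → R → BalanceChannel)`: the deciding crux follows from the shared
sibling crux (stmt-4981 ≡ stmt-10649) and the route's bookkeeping. -/
theorem balanceChannel_of_avoidanceLimit (hAL : AvoidanceLimit) (hDI : DefectIdentity)
    (hV : ExcursionInitialValue) (hR : CubicRemainder) : BalanceChannel :=
  (balanceChannel_iff_avoidanceLimit hDI hV hR).2 hAL

/-- The open support item `DefectToAvoidance` (stmt-CriticalPhenomena-7521), BY NAME. -/
theorem defectToAvoidance : DefectToAvoidance :=
  fun hDI hV hB hR => (balanceChannel_iff_avoidanceLimit hDI hV hR).1 hB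

/-- **`SAWScalingLimit → (DI → V → R → BalanceChannel)`**: the crux is a consequence of the
sub-problem modulo bookkeeping, through the landed `avoidanceLimit_of_sawScalingLimit` and the
`rfl`-transfer 10649 → 4981. -/
theorem balanceChannel_of_sawScalingLimit (hS : _root_.SAWScalingLimit) (hDI : DefectIdentity)
    (hV : ExcursionInitialValue) (hR : CubicRemainder) : BalanceChannel :=
  balanceChannel_of_avoidanceLimit
    (Theorems.AvoidanceLimit.steinDefect_of_loopFugacityFlow
      (Theorems.SAWChargeContinuation.avoidanceLimit_of_sawScalingLimit hS)) hDI hV hR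

end Summit.CriticalPhenomena.SAWScalingLimit.Cruxes.BalanceChannel.Strategist

end
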